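import Mathlib
import Literature.MathematicalPhysics.StatisticalMechanics.LocalMatchingCompactness
import Summits.AtomisticToContinuum.Crystallization.Theorems.CleanLimitsHaveWindows.Negative.RulerStackingClean

/-!
# `CleanLimitsHaveWindows` (stmt-AtomisticToContinuum-15932), negative side II:
# the ruler word and the cluster sequence

Support file 2/4 of `cleanLimitsHaveWindows_false_without_groundState` (standing disprover
refuter-cdisprove-stmt-AtomisticToContinuum-15932-0).

* `exists_ruler` — a Hägg sequence with NO `m`-periodic stretch of `4m + 1` consecutive
  comparisons, for every `m ≥ 1` (the 2-adic ruler word `k ↦ (−1)^{ν₂ |k|}`: with `m = 2ᵃ b`,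
  `b` odd, the comparison `k ↦ k + m` flips the parity of `ν₂` at every other `k ≡ 2ᵃ (mod 2ᵃ⁺¹)`);
* `exists_clusters` — for the unit ideal stacking `Y = barlowStacking 1 √(2/3) s` of any Hägg
  sequence: injective `N`-particle configurations `x N ⊆ Y` sandwiched between the balls of radii
  `ρ N − 1` and `ρ N`, with `ρ N → ∞`;
* `localLimit_of_clusters` — such a sequence has `Y` as a local limit along `φ = id` with no
  translations: verbatim the crux's local-limit clause (hypothesis H4).

No definitions. All `[folklore]`.
-/

noncomputable section

namespace Summit.AtomisticToContinuum.Crystallization.Theorems.CleanLimitsHaveWindows.Negative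

open Literature.MathematicalPhysics.StatisticalMechanics Filter

/-! ### The 2-adic ruler word -/

/-- **The ruler word.** There is a Hägg sequence `r` such that for every `m ≥ 1` and every `k₁`
some comparison `r (k + m) ≠ r k` fails within `k ∈ [k₁, k₁ + 4m]`: no stretch of the word is
`m`-periodic over `4m + 1` consecutive positions. Witness `r k = (−1)^{ν₂ |k|}` (`r 0 = 1`).
[folklore] -/
theorem exists_ruler : ∃ r : ℤ → ℤ, IsHaggSeq r ∧
    ∀ m : ℤ, 0 < m → ∀ k₁ : ℤ, ∃ k, k₁ ≤ k ∧ k ≤ k₁ + 4 * m ∧ r (k + m) ≠ r k := by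
  let r : ℤ → ℤ := fun k => if Even (padicValNat 2 k.natAbs) then 1 else -1
  have hval : ∀ (a : ℕ) {q : ℕ}, Odd q → padicValNat 2 (2 ^ a * q) = a := by
    intro a q hq
    have hq0 : q ≠ 0 := by rintro rfl; exact absurd hq (by decide)
    rw [padicValNat.mul (pow_ne_zero _ two_ne_zero) hq0, padicValNat.prime_pow,
      padicValNat.eq_zero_of_not_dvd hq.not_two_dvd_nat, add_zero]
  have hr : ∀ (a : ℕ) {q : ℤ}, Odd q → r (2 ^ a * q) = if Even a then 1 else -1 := by
    intro a q hq
    show (if Even (padicValNat 2 (2 ^ a * q).natAbs) then (1 : ℤ) else -1) = _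
    rw [Int.natAbs_mul, Int.natAbs_pow, show (2 : ℤ).natAbs = 2 from rfl,
      hval a (Int.natAbs_odd.2 hq)]
  refine ⟨r, fun k => ?_, fun m hm k₁ => ?_⟩
  · show (if Even (padicValNat 2 k.natAbs) then (1 : ℤ) else -1) = 1 ∨
      (if Even (padicValNat 2 k.natAbs) then (1 : ℤ) else -1) = -1
    split_ifs <;> simp
  obtain ⟨a, b, hb, hmab⟩ := Nat.exists_eq_two_pow_mul_odd (n := m.toNat) (by omega)
  have hm' : m = 2 ^ a * (b : ℤ) := by
    have : ((m.toNat : ℕ) : ℤ) = m := Int.toNat_of_nonneg hm.le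
    rw [← this, hmab]; push_cast; ring
  set A : ℤ := 2 ^ a with hA
  have hA0 : 0 < A := by positivity
  have hb1 : (1 : ℤ) ≤ b := by exact_mod_cast hb.pos
  have hAm : A ≤ m := by rw [hm']; nlinarith
  -- `q = ⌈k₁ / A⌉`
  set q : ℤ := -((-k₁) / A) with hq
  have hq1 : k₁ ≤ A * q := by
    have := Int.ediv_mul_le (-k₁) hA0.ne'
    rw [hq]; linarith [mul_comm ((-k₁) / A) A]
  have hq2 : A * q < k₁ + A := by
    have := Int.lt_ediv_add_one_mul_self (-k₁) hA0
    rw [hq]; nlinarith [mul_comm ((-k₁) / A) A]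
  -- an odd `q' ∈ {q, q + 1}`
  obtain ⟨q', hq'odd, hqq', hq'q⟩ : ∃ q', Odd q' ∧ q ≤ q' ∧ q' ≤ q + 1 := by
    rcases Int.even_or_odd q with h | h
    · exact ⟨q + 1, h.add_one, by omega, le_rfl⟩
    · exact ⟨q, h, le_rfl, by omega⟩
  have hbz : Odd (b : ℤ) := by exact_mod_cast hb
  obtain ⟨c, hc⟩ : ∃ c : ℤ, q' + b = 2 * c := by
    obtain ⟨c, hc⟩ := Odd.add_odd hq'odd hbz
    exact ⟨c, by omega⟩
  -- the comparison at `k = A q''` (`q''` odd) versus `k + m = 2A c''` (`c''` odd) fails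
  have key : ∀ q'' c'' : ℤ, Odd q'' → Odd c'' → q'' + b = 2 * c'' →
      r (A * q'' + m) ≠ r (A * q'') := by
    intro q'' c'' hqo hco hsum
    have e1 : A * q'' + m = 2 ^ (a + 1) * c'' := by
      rw [hm', hA, pow_succ]; linear_combination (2 ^ a : ℤ) * hsum
    rw [e1, hA, hr (a + 1) hco, hr a hqo]
    rcases Nat.even_or_odd a with ha | ha
    · rw [if_pos ha, if_neg (Nat.not_even_iff_odd.2 ha.add_one)]; norm_num
    · rw [if_neg (Nat.not_even_iff_odd.2 ha), if_pos ha.add_one]; norm_num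
  rcases Int.even_or_odd c with hce | hco
  · refine ⟨A * (q' + 2), by nlinarith, by nlinarith, ?_⟩
    exact key (q' + 2) (c + 1) (hq'odd.add_even even_two) hce.add_one (by omega)
  · exact ⟨A * q', by nlinarith, by nlinarith, key q' c hq'odd hco hc⟩

/-! ### The cluster sequence of the unit ideal stacking -/

/-- The axis points `i u`, `i ∈ ℕ`, have norm `i`. [folklore] -/
theorem norm_barlowPos_axis (s : ℤ → ℤ) (i : ℕ) : ‖barlowPos 1 (Real.sqrt (2 / 3)) s 0 i 0‖ = i := by
  rw [EuclideanSpace.norm_eq, Fin.sum_univ_three]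
  simp [Real.sqrt_sq (Nat.cast_nonneg i)]

/-- **The cluster sequence.** For the unit ideal stacking `Y` of a Hägg sequence there are injective
`N`-particle configurations `x N` made of points of `Y`, of norm `≤ ρ N`, containing every point of
`Y` of norm `≤ ρ N − 1`, with `ρ N → ∞` (take `ρ N` maximal with `#(Y ∩ B̄(0, ρ N − 1)) ≤ N` and fill
up with points of the next unit shell). [folklore] -/
theorem exists_clusters {s : ℤ → ℤ} (hs : IsHaggSeq s) :
    ∃ (x : (N : ℕ) → (Fin N → (EuclideanSpace ℝ (Fin 3)))) (ρ : ℕ → ℕ), (∀ N, Function.Injective (x N)) ∧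
      (∀ N i, x N i ∈ barlowStacking 1 (Real.sqrt (2 / 3)) s ∧ ‖x N i‖ ≤ ρ N) ∧
      (∀ N, ∀ p ∈ barlowStacking 1 (Real.sqrt (2 / 3)) s, ‖p‖ ≤ ρ N - 1 → ∃ i : Fin N, x N i = p) ∧
      (∀ r : ℕ, ∃ N₀ : ℕ, ∀ N, N₀ ≤ N → r ≤ ρ N) := by
  classical
  -- separation and finiteness of balls
  have hsep : ∀ p ∈ barlowStacking 1 (Real.sqrt (2 / 3)) s, ∀ q ∈ barlowStacking 1 (Real.sqrt (2 / 3)) s, p ≠ q →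
      (1 : ℝ) ≤ dist p q :=
    fun _ hp _ hq hpq => le_dist_of_mem_barlowStacking_ideal hs one_pos (by rw [Real.sq_sqrt (by norm_num)]; ring) hp hq hpq
  have hfin : ∀ r : ℝ, {p ∈ barlowStacking 1 (Real.sqrt (2 / 3)) s | ‖p‖ ≤ r - 1}.Finite := fun r =>
    finite_of_forall_le_dist_of_subset_closedBall one_pos
      (fun p hp q hq hpq => hsep p hp.1 q hq.1 hpq)
      (c := 0) (R := r - 1) (fun p hp => by simpa using hp.2)
  -- at least `r` points of norm `≤ r - 1`
  have hcnt : ∀ r : ℕ, r ≤ {p ∈ barlowStacking 1 (Real.sqrt (2 / 3)) s | ‖p‖ ≤ (r : ℝ) - 1}.ncard := by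
    intro r
    have hinj : Function.Injective (fun i : ℕ => barlowPos 1 (Real.sqrt (2 / 3)) s 0 i 0) := by
      intro i i' h
      have := congrArg (fun v : (EuclideanSpace ℝ (Fin 3)) => ‖v‖) h
      simp only [norm_barlowPos_axis] at this
      exact_mod_cast this
    calc r = ((Finset.range r).image fun i : ℕ => barlowPos 1 (Real.sqrt (2 / 3)) s 0 i 0).card := by
          rw [Finset.card_image_of_injective _ hinj, Finset.card_range]
      _ = (↑((Finset.range r).image fun i : ℕ => barlowPos 1 (Real.sqrt (2 / 3)) s 0 i 0) : Set (EuclideanSpace ℝ (Fin 3))).ncard :=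
          (Set.ncard_coe_finset _).symm
      _ ≤ {p ∈ barlowStacking 1 (Real.sqrt (2 / 3)) s | ‖p‖ ≤ (r : ℝ) - 1}.ncard := by
          refine Set.ncard_le_ncard ?_ (hfin r)
          intro p hp
          rw [Finset.coe_image, Set.mem_image] at hp
          obtain ⟨i, hi, rfl⟩ := hp
          refine ⟨barlowPos_mem _ _ _, ?_⟩
          rw [norm_barlowPos_axis]
          have : i < r := by simpa using hi
          have : (i : ℝ) + 1 ≤ r := by exact_mod_cast this
          linarith
  -- the inner radius `ρ N`
  have hrad : ∀ N : ℕ, ∃ ρ : ℕ, {p ∈ barlowStacking 1 (Real.sqrt (2 / 3)) s | ‖p‖ ≤ (ρ : ℝ) - 1}.ncard ≤ N ∧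
      N < {p ∈ barlowStacking 1 (Real.sqrt (2 / 3)) s | ‖p‖ ≤ ((ρ + 1 : ℕ) : ℝ) - 1}.ncard ∧
      ∀ r : ℕ, {p ∈ barlowStacking 1 (Real.sqrt (2 / 3)) s | ‖p‖ ≤ (r : ℝ) - 1}.ncard ≤ N → r ≤ ρ := by
    intro N
    set S : Set ℕ := {r : ℕ | {p ∈ barlowStacking 1 (Real.sqrt (2 / 3)) s | ‖p‖ ≤ (r : ℝ) - 1}.ncard ≤ N} with hS
    have h0 : 0 ∈ S := by
      have he : {p ∈ barlowStacking 1 (Real.sqrt (2 / 3)) s | ‖p‖ ≤ ((0 : ℕ) : ℝ) - 1} = ∅ := by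
        ext p
        simp only [Set.mem_setOf_eq, Set.mem_empty_iff_false, iff_false, not_and, Nat.cast_zero]
        intro _ h
        linarith [norm_nonneg p]
      show {p ∈ barlowStacking 1 (Real.sqrt (2 / 3)) s | ‖p‖ ≤ ((0 : ℕ) : ℝ) - 1}.ncard ≤ N
      rw [he, Set.ncard_empty]
      exact Nat.zero_le N
    have hbdd : BddAbove S := ⟨N, fun r hr => (hcnt r).trans hr⟩
    refine ⟨sSup S, Nat.sSup_mem ⟨0, h0⟩ hbdd, ?_, fun r hr => le_csSup hbdd hr⟩
    by_contra h
    push Not at h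
    have := le_csSup hbdd (show sSup S + 1 ∈ S from h)
    omega
  choose ρ hρ using hrad
  -- the clusters
  have hS : ∀ N, ∃ S : Finset (EuclideanSpace ℝ (Fin 3)), (hfin (ρ N)).toFinset ⊆ S ∧
      S ⊆ (hfin ((ρ N + 1 : ℕ) : ℝ)).toFinset ∧ S.card = N := by
    intro N
    apply Finset.exists_subsuperset_card_eq
    · exact Set.Finite.toFinset_subset_toFinset.2 fun p hp =>
        ⟨hp.1, hp.2.trans (by push_cast; linarith)⟩
    · rw [← Set.ncard_eq_toFinset_card _ (hfin _)]; exact (hρ N).1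
    · rw [← Set.ncard_eq_toFinset_card _ (hfin _)]; exact (hρ N).2.1.le
  choose S hS using hS
  refine ⟨fun N i => (((S N).equivFinOfCardEq (hS N).2.2).symm i : (EuclideanSpace ℝ (Fin 3))), ρ, ?_, ?_, ?_, ?_⟩
  · intro N i j h
    exact ((S N).equivFinOfCardEq (hS N).2.2).symm.injective (Subtype.ext h)
  · intro N i
    have h := (hS N).2.1 (((S N).equivFinOfCardEq (hS N).2.2).symm i).2
    rw [Set.Finite.mem_toFinset] at h
    refine ⟨h.1, ?_⟩
    have := h.2
    push_cast at this
    linarith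
  · intro N p hp hpn
    have hmem : p ∈ S N := (hS N).1 (by rw [Set.Finite.mem_toFinset]; exact ⟨hp, hpn⟩)
    exact ⟨(S N).equivFinOfCardEq (hS N).2.2 ⟨p, hmem⟩, by simp⟩
  · intro r
    exact ⟨{p ∈ barlowStacking 1 (Real.sqrt (2 / 3)) s | ‖p‖ ≤ (r : ℝ) - 1}.ncard, fun N hN => (hρ N).2.2 r hN⟩

/-- **(H4) A sandwiched cluster sequence has the ambient set as a local limit**, along `φ = id` and
with no translations — verbatim the local-limit clause of the crux. [folklore] -/
theorem localLimit_of_clusters {Y : Set (EuclideanSpace ℝ (Fin 3))} {x : (N : ℕ) → (Fin N → (EuclideanSpace ℝ (Fin 3)))} {ρ : ℕ → ℕ}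
    (hx : ∀ N i, x N i ∈ Y) (hfill : ∀ N, ∀ p ∈ Y, ‖p‖ ≤ ρ N - 1 → ∃ i : Fin N, x N i = p)
    (hρ : ∀ r : ℕ, ∃ N₀ : ℕ, ∀ N, N₀ ≤ N → r ≤ ρ N) :
    ∃ (φ : ℕ → ℕ) (t : ℕ → (EuclideanSpace ℝ (Fin 3))), StrictMono φ ∧ ∀ R ε : ℝ, 0 < ε → ∀ᶠ n in atTop,
      (∀ y ∈ Y, ‖y‖ ≤ R → ∃ i : Fin (φ n), dist (x (φ n) i + t n) y ≤ ε) ∧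
      (∀ i : Fin (φ n), ‖x (φ n) i + t n‖ ≤ R → ∃ y ∈ Y, dist (x (φ n) i + t n) y ≤ ε) := by
  refine ⟨id, fun _ => 0, strictMono_id, fun R ε hε => ?_⟩
  obtain ⟨N₀, hN₀⟩ := hρ (⌈R⌉₊ + 1)
  filter_upwards [eventually_ge_atTop N₀] with n hn
  have hrad : ⌈R⌉₊ + 1 ≤ ρ n := hN₀ n hn
  refine ⟨fun y hy hyR => ?_, fun i _ => ⟨x n i, hx n i, by simp [hε.le]⟩⟩
  have hR : R ≤ ⌈R⌉₊ := Nat.le_ceil R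
  have hrad' : (⌈R⌉₊ : ℝ) + 1 ≤ ρ n := by exact_mod_cast hrad
  obtain ⟨i, hi⟩ := hfill n y hy (by linarith)
  exact ⟨i, by simp [hi, hε.le]⟩

end Summit.AtomisticToContinuum.Crystallization.Theorems.CleanLimitsHaveWindows.Negative

end
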